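import Mathlib.NumberTheory.Padics.RingHoms
import Mathlib.Topology.LocallyConstant.Basic
import Mathlib.Topology.Algebra.Group.Basic
import Literature.NumberTheory.GaloisRepresentations.ResidualGaloisRep
import Literature.NumberTheory.GaloisRepresentations.GSpValued
import Literature.NumberTheory.FaltingsSerre.Deviation
import HarnessLib

/-!
# The Faltings–Serre method after Brumer–Pacetti–Poor–Tornaría–Voight–Yuen, II: the criterion

The ABSTRACT KERNEL of [BPPTVY] = A. Brumer, A. Pacetti, C. Poor, G. Tornaría, J. Voight, D. S. Yuen,
*On the paramodularity of typical abelian surfaces*, Algebra & Number Theory **13**:5 (2019)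
1145–1195 [cite: BrumerEtAl2019] — PRINTED numbering and pages throughout (the arXiv:1805.10873v4
text carries the same statements; see "Numbering" below) — §2: Theorem 2.1.5 (p. 1150) with the
correctness proof of Algorithm 2.4.1 (pp. 1156–1157), which rests on Lemma 2.3.6 (the deviation
cocycle, p. 1153), Proposition 2.3.14 (p. 1154) and Corollary 2.3.19 (p. 1155), Theorem 2.1.4
(Carayol, p. 1150) and, for the symplectic refinement, Lemma 2.3.20 / Remark 2.4.2 (p. 1156) — typed
as NAMED FACTS (`def … : Prop`, no `sorry`, D-0014) in which EVERY hypothesis of the printed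
criterion is a binder, so that a *certificate* (`ParamodularCertificate.lean`) is nothing but a
witness of the hypotheses.

[BPPTVY, Thm. 2.1.5, p. 1150] (verbatim): "There is a deterministic algorithm that takes as input an
algebraic group `G` over `ℚ`, a number field `F`, a finite set `S` of primes of `F`, a prime `ℓ`, and
`ρ₁, ρ₂ : Gal_{F,S} → G(ℤ_ℓ)` trace computable representations with `ρ̄₁, ρ̄₂` absolutely
irreducible, (2.1.6) and gives as output `true` if `ρ₁ ≃ ρ₂`; `false` and a witness prime `𝔭 ∉ S`
if `ρ₁ ≄ ρ₂`.  The algorithm does not operate on the representations `ρ₁, ρ₂` themselves, only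
their traces."  [BPPTVY, Algorithm 2.4.1, p. 1156] (verbatim): "The following algorithm takes as
input the data (2.1.6) and gives as output `true` if `ρ₁ ≃ ρ₂`; `false` and a witness prime if
`ρ₁ ≄ ρ₂`.  1. Apply Algorithm 2.2.3; if `ρ̄₁ ≄ ρ̄₂`, return false and the witness prime `𝔭`.
Otherwise, let `K` be the fixed field under the common residual representation `ρ̄`.  2. Using the
algorithm of Lemma 2.2.1, enumerate all `ℓ`-elementary abelian extensions `L ⊇ K` unramified away
from `S` and such that `Gal(L | F)` is isomorphic to a subgroup of `(Lie(G) ⋊ G)(𝔽_ℓ)`.  3. For each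
of these finitely many fields `L`, by enumeration of injective group homomorphisms
`Gal(L | F) ↪ (Lie(G) ⋊ G)(𝔽_ℓ)`, find all obstructing pairs `(L, φ)` extending `(K, ρ̄)` up to
conjugation by `(M_n ⋊ GL_n)(𝔽_ℓ)`.  4. For each such pair `(L, φ)`, find a prime `𝔭 ∉ S` such that
`utr φ(Frob_𝔭) ≢ 0 (mod ℓ)`.  5. Check if `tr ρ₁(Frob_𝔭) = tr ρ₂(Frob_𝔭)` for the primes in Step 4.
If equality holds for all primes, return true; if equality fails for `𝔭`, return false and the prime
`𝔭`."  Proof of correctness (pp. 1156–1157, verbatim): "Otherwise, we return true and we claim that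
`ρ₁ ≃ ρ₂` so the output is correct.  Indeed, assume for purposes of contradiction that `ρ₁ ≄ ρ₂`.
Then there exists `r ≥ 1` such that `ρ₁ ≃ ρ₂ (mod ℓ^r)` but `ρ₁ ≄ ρ₂ (mod ℓ^{r+1})`.  We can assume
as before that `ρ₁ ≡ ρ₂ (mod ℓ^r)`.  We define `μ` by (2.3.5) and `φ_μ` by (2.3.13).  Let `L_μ` be
the fixed field of `φ_μ`.  By Lemma 2.3.6 we have `μ ∉ B¹(F, Lie(G)(𝔽_ℓ); M_n(𝔽_ℓ))`, hence by
Corollary 2.3.19 `φ_μ` extends `ρ̄` and is obstructing.  It follows that the pair `(L_μ, φ_μ)` is,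
up to conjugation by `(M_n ⋊ GL_n)(𝔽_ℓ)`, among the pairs computed in Step 3.  In particular there
is a prime `𝔭` in Step 4 such that `utr φ_μ(Frob_𝔭) ≢ 0 (mod ℓ)`.  But then by (2.3.15) we would
have `tr ρ₁(Frob_𝔭) ≢ tr ρ₂(Frob_𝔭)`, contradicting the verification carried out in Step 5.  The
correctness of Algorithm 2.4.1 then proves Theorem 2.1.5."

## How the printed criterion is typed (the dictionary; schematic choices in the cell's DIVERGENCE.md)

* `Gal_{F,S}`, `Frob_𝔭` ↦ an arbitrary topological group `Γ` with a set `I ⊆ Γ` ("inertia outside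
  `S`": both `ρᵢ` are trivial on `I`, binder `hI`) and a set `T ⊆ Γ` ("the Frobenius elements at the
  primes found in Step 4").  Nothing about number fields is used by the implication; Chebotarev,
  Hermite and class field theory only make Steps 2–4 FINITE and are the business of whoever
  discharges the binder `complete` below (in [BPPTVY]: Magma + PARI/GP, Theorems 5.3.1 and 5.3.3,
  p. 1176, and §6).
* `G(ℤ_ℓ)`-valued ↦ (a) `G = GL_n`: no condition (`traceEq_of_faltingsSerre`);
  (b) `G = GSp(J)`: `J` alternating with unit determinant and `ρ₁, ρ₂` similitudes of `J` with THE SAME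
  multiplier `ν` (`traceEq_of_faltingsSerre_symplectic`).  This replaces [BPPTVY, Lemma 2.3.20 /
  Remark 2.4.2, p. 1156] ("if we know that `det ρ₁ = det ρ₂`, then we can replace `Lie(G)` by
  `Lie⁰(G)`", `Lie⁰(G) ≤ Lie(G)` "the subgroup of trace zero matrices") and [BPPTVY, (5.1.2),
  p. 1173] ("`Lie⁰(GSp₄)(𝔽₂) = 𝔰𝔭₄(𝔽₂) = {A ∈ M₄(𝔽₂) : AᵀJ + JA = 0} ≃ 𝔽₂¹⁰`"): in characteristic `2`
  the trace-zero part of `𝔤𝔰𝔭₄(𝔽₂)` is NOT `𝔰𝔭₄(𝔽₂)` (`Deviation.gspLie_ne_spLie_char_two`: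
  `diag(1,1,0,0)` has trace `0`, lies in `𝔤𝔰𝔭₄(𝔽₂)` and not in `𝔰𝔭₄(𝔽₂)`), whereas equality of
  multipliers gives `(1 + ℓ^r μ)ᵀ J (1 + ℓ^r μ) = J`, hence `μ̄ᵀ J̄ + J̄ μ̄ = 0`, i.e.
  `μ̄ ∈ 𝔰𝔭(J̄)(𝔽_ℓ)` — which is what §§5–7 of [BPPTVY] actually use (both `ρ_{A,2}` and `ρ_{f,2}`
  have cyclotomic similitude character: (4.1.3) p. 1163 and Thm. 4.3.4(ii) p. 1169).
* "`ρ̄₁ ≃ ρ̄₂`" (output of Algorithm 2.2.3, p. 1151) ↦ EQUALITY `residual ρ₁ = residual ρ₂` after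
  conjugating `ρ₂` in `GL_n(ℤ_ℓ)` ([BPPTVY, p. 1157]: "We can assume as before that
  `ρ₁ ≡ ρ₂ (mod ℓ^r)`"; traces are conjugation invariant, so the conclusion is unaffected).
* "`ρ̄` absolutely irreducible" ↦ `IsAbsIrreducible (residual ρ₁)` (tree notion, over `ZMod ℓ`).
* Steps 2–4 ↦ the binder `complete`: EVERY locally constant deviation cocycle `μ` of `ρ̄`
  ([BPPTVY, (2.3.2)]) vanishing on `I` (and, in (b), valued in `𝔰𝔭(J̄)`) that is obstructing
  (Def. 2.3.18) has an obstructing element in `T`.  (Restricting to locally constant `μ` vanishing on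
  `I` is what makes the set of `(L_μ, φ_μ)` finite in the number-field case; the cocycle (2.3.5) of
  two continuous `ρᵢ` unramified outside `S` is such.)
* Step 5 ↦ the binder `traces`: `tr ρ₁ = tr ρ₂` on `T`.
* Output `true`, i.e. `ρ₁ ≃ ρ₂` ↦ `∀ σ, tr ρ₁(σ) = tr ρ₂(σ)`; conjugacy `ρ₂ = P ρ₁ P⁻¹` then follows
  from the tree's PROVED Carayol theorem
  `Literature.NumberTheory.GaloisRepresentations.exists_conj_eq_of_trace_eq_of_isAbsIrreducible_residual_holds`
  (this is [BPPTVY, Thm. 2.1.4] over `ℤ_ℓ`), see `ParamodularCertificate.lean`.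

Why the facts are true as typed (proof = [BPPTVY] pp. 1152–1157 verbatim, plus two routine remarks):
(i) if `tr ρ₁ ≠ tr ρ₂` somewhere then `r := max {r : ρ₁ ≃ ρ₂ mod ℓ^r}` exists (`r ≥ 1` by `h0`,
bounded by the `ℓ`-adic valuation of a trace difference); (ii) in case (b), the conjugating matrix
`P ∈ GL_n(ℤ_ℓ)` with `Pρ₂P⁻¹ ≡ ρ₁ (mod ℓ^r)` is a similitude of `J` modulo `ℓ^r` (Schur modulo `ℓ^r`
for the residually absolutely irreducible `ρ₁`, Burnside + Nakayama as in the tree's Carayol file)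
and lifts to `GSp(J)(ℤ_ℓ)` because `GSp(J)` is smooth over `ℤ_ℓ` for `J` alternating with unit
determinant (Hensel); then `ρ₁(σ)(Pρ₂P⁻¹)(σ)⁻¹ = 1 + ℓ^r μ̃(σ)` is a similitude with multiplier `1`,
whence `μ̄ ∈ 𝔰𝔭(J̄)`; (iii) Carayol's theorem is applied over `ℤ/ℓ^{r+1}` (a local Artinian ring).
A full formal proof from the tree's Carayol file is feasible and left as a prover target; until then
both statements are cited facts used as hypotheses `(h : traceEq_of_faltingsSerre)`.

## Numbering

All numbers and pages are those of the PRINTED ANT version (verified against the MSP issue text).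
The sequential numbers produced by flattening the arXiv v4 TeX source (as they appear in some of this
programme's notes and in the docstrings of `Deviation.lean`) correspond as follows: Thm 6 = Thm 2.1.4,
Thm 7 = Thm 2.1.5, Alg 10 = Alg 2.2.3, Lemma 12 = Lemma 2.3.6, Lemma 13 = Lemma 2.3.11,
Prop 14 = Prop 2.3.14, Def 15 = Def 2.3.17, Def 16 = Def 2.3.18, Cor 17 = Cor 2.3.19,
Lemma 18 = Lemma 2.3.20, Alg 19 = Alg 2.4.1, Rem 20 = Rem 2.4.2; equations (2.7) = (2.3.2),
(2.8) = (2.3.3), (2.10) = (2.3.5), (2.12) = (2.3.9), (2.13) = (2.3.13), (2.14) = (2.3.15),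
(5.3) = (5.1.2); arXiv "p. 6–9" = printed pp. 1150–1157, "p. 18" = p. 1173.

## References

* [BPPTVY] A. Brumer, A. Pacetti, C. Poor, G. Tornaría, J. Voight, D. S. Yuen, Algebra & Number
  Theory 13:5 (2019) 1145–1195, doi:10.2140/ant.2019.13.1145: Thm. 2.1.4, Thm. 2.1.5 (p. 1150),
  Alg. 2.2.3 (p. 1151), (2.3.2)–(2.3.5) and Lemma 2.3.6 (p. 1153), Lemma 2.3.11, (2.3.13),
  Prop. 2.3.14 (p. 1154), Def. 2.3.18, Cor. 2.3.19 (p. 1155), Lemma 2.3.20, Alg. 2.4.1, Rem. 2.4.2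
  (p. 1156); (5.1.2) p. 1173.  [cite: BrumerEtAl2019]
* R. Livné, Contemp. Math. 67 (1987), Thm. 4.3 (the quadratic-extension test at `ℓ = 2`).
  [cite: Livne1987]
* H. Carayol, Contemp. Math. 165 (1994), Thm. 1 (tree: `CarayolSerreLemmas`).
-/

noncomputable section

namespace Literature.NumberTheory.FaltingsSerre

open Matrix Literature.NumberTheory.GaloisRepresentations

section Residual

variable {ℓ : ℕ} [Fact ℓ.Prime] {Γ : Type*} [Group Γ] {n : ℕ}

/-- The residual representation `ρ̄ = ρ mod ℓ : Γ → GL_n(𝔽_ℓ)` of `ρ : Γ → GL_n(ℤ_ℓ)`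
(`𝔽_ℓ = ZMod ℓ`, reduction `PadicInt.toZMod`; [BPPTVY, §2.1 p. 1150]: the residual representation
`ρ̄ = ρ mod ℓ : Gal_{F,S} → G(𝔽_ℓ)`). [cite: BrumerEtAl2019, §2.1 p. 1150] -/
def residual (ρ : Γ →* GL (Fin n) ℤ_[ℓ]) : Γ →* GL (Fin n) (ZMod ℓ) :=
  (Matrix.GeneralLinearGroup.map (PadicInt.toZMod (p := ℓ))).comp ρ

/-- Unfolding lemma: the entries of `ρ̄(σ)` are the reductions of the entries of `ρ(σ)`. [cite: BrumerEtAl2019, §2.1 p. 1150] -/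
theorem residual_apply_coe (ρ : Γ →* GL (Fin n) ℤ_[ℓ]) (σ : Γ) :
    ((residual ρ σ : GL (Fin n) (ZMod ℓ)) : Matrix (Fin n) (Fin n) (ZMod ℓ)) =
      ((ρ σ : GL (Fin n) ℤ_[ℓ]) : Matrix (Fin n) (Fin n) ℤ_[ℓ]).map (PadicInt.toZMod (p := ℓ)) :=
  rfl

/-- Conjugate representations have the same traces (the output "`ρ₁ ≃ ρ₂`" of Thm. 2.1.5 implies the
typed conclusion; Def. 2.1.1 p. 1150). [folklore] -/
theorem trace_eq_of_conj {R : Type*} [CommRing R] {ρ₁ ρ₂ : Γ →* GL (Fin n) R} {P : GL (Fin n) R}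
    (h : ∀ σ, ρ₂ σ = P * ρ₁ σ * P⁻¹) (σ : Γ) :
    ((ρ₁ σ : GL (Fin n) R) : Matrix (Fin n) (Fin n) R).trace = ((ρ₂ σ : GL (Fin n) R) : Matrix (Fin n) (Fin n) R).trace := by
  rw [h σ, Units.val_mul, Units.val_mul, Matrix.trace_mul_cycle, Units.inv_mul, Matrix.one_mul]

end Residual

/-! ### The criterion, `G = GL_n` -/

/-- **The Faltings–Serre criterion after [BPPTVY, Thm. 2.1.5 / Algorithm 2.4.1], `G = GL_n`** (named fact).
For a prime `ℓ`, a topological group `Γ`, continuous `ρ₁ ρ₂ : Γ → GL_n(ℤ_ℓ)`, and sets `I, T ⊆ Γ`: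
IF (`h0`, Step 1 / Algorithm 2.2.3) the residual representations are equal, `ρ̄₁ = ρ̄₂ =: ρ̄`;
(`hirr`) `ρ̄` is absolutely irreducible; (`hI`, "unramified outside `S`") `ρ₁` and `ρ₂` are trivial
on `I`; (`complete`, Steps 2–4) every locally constant deviation cocycle `μ : Γ → M_n(𝔽_ℓ)` of `ρ̄`
(`μ(στ) = μ(σ) + ρ̄(σ)μ(τ)ρ̄(σ)⁻¹`, [BPPTVY, (2.3.2)]) vanishing on `I` which is obstructing
(`utr φ_μ ≢ 0`, Def. 2.3.18) has an obstructing element in `T` (`tr(μ(σ)ρ̄(σ)) ≠ 0` for some `σ ∈ T`);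
and (`traces`, Step 5) `tr ρ₁(σ) = tr ρ₂(σ)` for all `σ ∈ T` — THEN `tr ρ₁ = tr ρ₂` identically (whence
`ρ₁ ≃ ρ₂` by Carayol, Thm. 2.1.4).  This is the correctness proof of Algorithm 2.4.1 (pp. 1156–1157)
with Lemma 2.3.6, Prop. 2.3.14(c) and Cor. 2.3.19, read for an arbitrary topological group. [cite: BrumerEtAl2019, Thm. 2.1.5 p. 1150 and Algorithm 2.4.1 with proof of correctness pp. 1156–1157; Lemma 2.3.6, Prop. 2.3.14, Cor. 2.3.19] -/
def traceEq_of_faltingsSerre : Prop :=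
  ∀ (ℓ : ℕ) [Fact ℓ.Prime] (Γ : Type) [Group Γ] [TopologicalSpace Γ] [IsTopologicalGroup Γ] (n : ℕ)
    (ρ₁ ρ₂ : Γ →* GL (Fin n) ℤ_[ℓ]) (_ : Continuous ρ₁) (_ : Continuous ρ₂) (I T : Set Γ)
    (_h0 : residual ρ₁ = residual ρ₂)
    (_hirr : IsAbsIrreducible (residual ρ₁))
    (_hI : ∀ σ ∈ I, ρ₁ σ = 1 ∧ ρ₂ σ = 1)
    (_complete : ∀ μ : Γ → Matrix (Fin n) (Fin n) (ZMod ℓ), IsLocallyConstant μ → (∀ σ ∈ I, μ σ = 0) →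
      IsDeviationCocycle (residual ρ₁) μ → IsObstructing (residual ρ₁) μ →
      ∃ σ ∈ T, IsObstructingElt (residual ρ₁) μ σ)
    (_traces : ∀ σ ∈ T, ((ρ₁ σ : GL (Fin n) ℤ_[ℓ]) : Matrix (Fin n) (Fin n) ℤ_[ℓ]).trace =
      ((ρ₂ σ : GL (Fin n) ℤ_[ℓ]) : Matrix (Fin n) (Fin n) ℤ_[ℓ]).trace),
    ∀ σ : Γ, ((ρ₁ σ : GL (Fin n) ℤ_[ℓ]) : Matrix (Fin n) (Fin n) ℤ_[ℓ]).trace =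
      ((ρ₂ σ : GL (Fin n) ℤ_[ℓ]) : Matrix (Fin n) (Fin n) ℤ_[ℓ]).trace

/-! ### The criterion, `G = GSp(J)` (the refinement actually used for `GSp₄(𝔽₂)`) -/

/-- **The Faltings–Serre criterion after [BPPTVY, Thm. 2.1.5 / Algorithm 2.4.1 with Lemma 2.3.20 and
Remark 2.4.2], `G = GSp(J)`** (named fact).  As `traceEq_of_faltingsSerre`, for `ρ₁, ρ₂` that are
similitudes of a fixed alternating form `J` (`Jᵀ = -J`, zero diagonal, `det J ∈ ℤ_ℓˣ`) with THE SAME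
multiplier function `ν : Γ → ℤ_ℓ` (`ρᵢ(σ)ᵀ J ρᵢ(σ) = ν(σ) J`, tree notion
`Literature.NumberTheory.GaloisRepresentations.IsSimilitude`), the completeness binder is only
required for cocycles valued in `𝔰𝔭(J̄)(𝔽_ℓ) = {a : aᵀ J̄ + J̄ a = 0}` (`Deviation.spLie`, [BPPTVY,
(5.1.2) p. 1173]): [BPPTVY, Remark 2.4.2 p. 1156] "if we know that `det ρ₁ = det ρ₂`, then we can
replace `Lie(G)` by `Lie⁰(G)` by Lemma 2.3.20", typed with equality of multipliers in place of equality
of determinants (see the module docstring: in characteristic `2` the trace-zero condition of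
Lemma 2.3.20 does not cut `𝔤𝔰𝔭₄` down to `𝔰𝔭₄`, equality of multipliers does).  This is the form instantiated with `n = 4`, `ℓ = 2`,
`J` = anti-identity, `ν` = cyclotomic character in [BPPTVY, §7]. [cite: BrumerEtAl2019, Thm. 2.1.5 p. 1150, Algorithm 2.4.1, Lemma 2.3.20, Remark 2.4.2 p. 1156 and (5.1.2)–(5.1.4) p. 1173] -/
def traceEq_of_faltingsSerre_symplectic : Prop :=
  ∀ (ℓ : ℕ) [Fact ℓ.Prime] (Γ : Type) [Group Γ] [TopologicalSpace Γ] [IsTopologicalGroup Γ] (n : ℕ)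
    (ρ₁ ρ₂ : Γ →* GL (Fin n) ℤ_[ℓ]) (_ : Continuous ρ₁) (_ : Continuous ρ₂) (I T : Set Γ)
    (J : Matrix (Fin n) (Fin n) ℤ_[ℓ]) (_hJ : IsUnit J.det) (_hJt : Jᵀ = -J) (_hJd : ∀ i, J i i = 0)
    (ν : Γ → ℤ_[ℓ])
    (_hν₁ : ∀ σ, IsSimilitude J (ν σ) ((ρ₁ σ : GL (Fin n) ℤ_[ℓ]) : Matrix (Fin n) (Fin n) ℤ_[ℓ]))
    (_hν₂ : ∀ σ, IsSimilitude J (ν σ) ((ρ₂ σ : GL (Fin n) ℤ_[ℓ]) : Matrix (Fin n) (Fin n) ℤ_[ℓ]))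
    (_h0 : residual ρ₁ = residual ρ₂)
    (_hirr : IsAbsIrreducible (residual ρ₁))
    (_hI : ∀ σ ∈ I, ρ₁ σ = 1 ∧ ρ₂ σ = 1)
    (_complete : ∀ μ : Γ → Matrix (Fin n) (Fin n) (ZMod ℓ), IsLocallyConstant μ → (∀ σ ∈ I, μ σ = 0) →
      ValuedIn (spLie (J.map (PadicInt.toZMod (p := ℓ)))) μ →
      IsDeviationCocycle (residual ρ₁) μ → IsObstructing (residual ρ₁) μ →
      ∃ σ ∈ T, IsObstructingElt (residual ρ₁) μ σ)
    (_traces : ∀ σ ∈ T, ((ρ₁ σ : GL (Fin n) ℤ_[ℓ]) : Matrix (Fin n) (Fin n) ℤ_[ℓ]).trace =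
      ((ρ₂ σ : GL (Fin n) ℤ_[ℓ]) : Matrix (Fin n) (Fin n) ℤ_[ℓ]).trace),
    ∀ σ : Γ, ((ρ₁ σ : GL (Fin n) ℤ_[ℓ]) : Matrix (Fin n) (Fin n) ℤ_[ℓ]).trace =
      ((ρ₂ σ : GL (Fin n) ℤ_[ℓ]) : Matrix (Fin n) (Fin n) ℤ_[ℓ]).trace

/-! ### Sanity checks of the shapes (PROVED) -/

section Sanity

/-- The `GL_n` criterion implies the symplectic one's conclusion whenever the `GL_n` completeness
binder is available (the symplectic binder is WEAKER: it quantifies over fewer cocycles); i.e. the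
refinement only ever removes work. [cite: BrumerEtAl2019, Remark 2.4.2 p. 1156] -/
theorem complete_symplectic_of_complete {ℓ : ℕ} [Fact ℓ.Prime] {Γ : Type*} [Group Γ]
    [TopologicalSpace Γ] {n : ℕ} (ρbar : Γ →* GL (Fin n) (ZMod ℓ)) (I T : Set Γ)
    (V : Set (Matrix (Fin n) (Fin n) (ZMod ℓ)))
    (h : ∀ μ : Γ → Matrix (Fin n) (Fin n) (ZMod ℓ), IsLocallyConstant μ → (∀ σ ∈ I, μ σ = 0) →
      IsDeviationCocycle ρbar μ → IsObstructing ρbar μ → ∃ σ ∈ T, IsObstructingElt ρbar μ σ) :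
    ∀ μ : Γ → Matrix (Fin n) (Fin n) (ZMod ℓ), IsLocallyConstant μ → (∀ σ ∈ I, μ σ = 0) →
      ValuedIn V μ → IsDeviationCocycle ρbar μ → IsObstructing ρbar μ →
      ∃ σ ∈ T, IsObstructingElt ρbar μ σ :=
  fun μ hlc hI _ hc ho => h μ hlc hI hc ho

/-- With `T = univ` ("check every element") the criterion is tautological: its conclusion is the
`traces` binder.  (Shape check: the content of the criterion is exactly that a FINITE `T` produced by
Steps 2–4 suffices.) [cite: BrumerEtAl2019, Algorithm 2.4.1 Step 5 p. 1156] -/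
theorem traceEq_of_traces_univ {ℓ : ℕ} [Fact ℓ.Prime] {Γ : Type*} [Group Γ] {n : ℕ}
    (ρ₁ ρ₂ : Γ →* GL (Fin n) ℤ_[ℓ])
    (traces : ∀ σ ∈ (Set.univ : Set Γ), ((ρ₁ σ : GL (Fin n) ℤ_[ℓ]) : Matrix (Fin n) (Fin n) ℤ_[ℓ]).trace =
      ((ρ₂ σ : GL (Fin n) ℤ_[ℓ]) : Matrix (Fin n) (Fin n) ℤ_[ℓ]).trace) (σ : Γ) :
    ((ρ₁ σ : GL (Fin n) ℤ_[ℓ]) : Matrix (Fin n) (Fin n) ℤ_[ℓ]).trace =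
      ((ρ₂ σ : GL (Fin n) ℤ_[ℓ]) : Matrix (Fin n) (Fin n) ℤ_[ℓ]).trace :=
  traces σ (Set.mem_univ σ)

/-- A coboundary never needs detecting: the completeness binder is only about cocycles that are not
coboundaries (an obstructing cocycle is not a coboundary, `Deviation.not_isObstructing_of_isDeviationCoboundary`).
[cite: BrumerEtAl2019, Cor. 2.3.19 p. 1155] -/
theorem not_isDeviationCoboundary_of_isObstructing {Γ : Type*} [Group Γ] {n : ℕ} {k : Type*}
    [CommRing k] {ρbar : Γ →* GL (Fin n) k} {μ : Γ → Matrix (Fin n) (Fin n) k}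
    (h : IsObstructing ρbar μ) : ¬ IsDeviationCoboundary ρbar μ :=
  fun hb => not_isObstructing_of_isDeviationCoboundary hb h

end Sanity

end Literature.NumberTheory.FaltingsSerre
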